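import Literature.NumberTheory.EllipticCurves.IwasawaAlgebraCharIdealProofs
import Literature.NumberTheory.EllipticCurves.IwasawaAlgebraStructureProofs
import Literature.NumberTheory.EllipticCurves.IwasawaAlgebraProofs
import Literature.NumberTheory.EllipticCurves.PAdicBSD

/-!
# Crux `SignedTransportAtTwo` (stmt-BirchSwinnertonDyer-20306, route `ThetaPartnerAtTwo`), line `birth`:
# stub `stub_unitOfInvariantsTwo` — an element of `Λ = ℤ₂⟦T⟧` with `μ = m`, `λ = 0` is `2^m ×` a unit
# (lead prover bsd-wall-tp2-p1, `--supports`)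

The registered stub `stub_unitOfInvariantsTwo` of the BC3 birth skeleton of the crux
`Summit.BirchSwinnertonDyer.BirchSwinnertonDyer.Theses.ThetaPartnerAtTwo.SignedTransportAtTwo`
(composition `SignedTransportAtTwo_of`): for `h ≠ 0` in `Λ = ℤ₂⟦T⟧` with
`μ(Λ/(h)) = m` and `λ(Λ/(h)) = 0` (the tree's `muInvariant` / `lambdaInvariant` of the cyclic module),
`ι h = 2^m · ι u` in `ℚ₂⟦T⟧` for a unit `u ∈ Λˣ`. In the composition this turns "the Kato cofactor
`h` in `g · h = 2^m ϖ L♭` has `μ = m`, `λ = 0`" into `(g) = (ϖ L♭)`.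

Pure `Λ`-algebra, proved for every prime `p` (§1) and specialised to `p = 2` (§2):
`p`-content `h = p^k · b`, `b ∉ pΛ` (`IwasawaAlgebra.exists_eq_C_pow_mul_and_map_residue_ne_zero`);
Weierstrass preparation `b = P · v`, `P` distinguished, `v` a unit (Mathlib
`PowerSeries.exists_isWeierstrassFactorization`, Washington Thm. 7.3); then
`μ(Λ/(p^k P)) = k` (local length at `(p)`: `lengthAt_quotient_span_singleton_mul`,
`lengthAt_quotient_C_pow`, and `P ∉ (p)`) and `λ(Λ/(p^k P)) = deg P` (`ℚ_p ⊗ Λ/(p^k P) ≅ ℚ_p ⊗ Λ/(P)`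
by `Module.finrank_baseChange_eq_of_pow_smul`, and `Λ/(P) ≅ ℤ_p^{deg P}` by Weierstrass division,
`finrank_quotient_pow`); so `λ = 0` forces `P = 1` and `μ = m` forces `k = m`.

References: [Washington1997] §7.1 Thm. 7.3, §13.2 (Lemma 13.7, Prop. 13.8); [Lang1980] Ch. 5 §2.
-/

-- D-0017: single-problem summit, so `Summit.BirchSwinnertonDyer.BirchSwinnertonDyer.…` repeats a
-- namespace BY DESIGN.
set_option linter.dupNamespace false
set_option autoImplicit false

noncomputable section

open scoped TensorProduct Polynomial

namespace Summit.BirchSwinnertonDyer.BirchSwinnertonDyer.Theorems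

open Literature Literature.NumberTheory.EllipticCurves
  Literature.NumberTheory.EllipticCurves.IwasawaAlgebra

/-! ## §1. `Λ = ℤ_p⟦T⟧`-algebra at any prime `p` -/

namespace SignedTransportAtTwo

variable (p : ℕ) [Fact p.Prime]

/-- `λ(M)` computed on any compatible `ℤ_p`-structure: if the `ℤ_p`-action on the `Λ`-module `M` is
the restriction of the `Λ`-action (`IsScalarTower`), then
`lambdaInvariant p M = dim_{ℚ_p} (ℚ_p ⊗_{ℤ_p} M)` (the definition uses `RestrictScalars ℤ_p Λ M`,
which is `M` with that very action). [folklore] -/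
theorem lambdaInvariant_eq_finrank (M : Type*) [AddCommGroup M] [Module (IwasawaAlgebra p) M]
    [Module ℤ_[p] M] [IsScalarTower ℤ_[p] (IwasawaAlgebra p) M] :
    lambdaInvariant p M = Module.finrank ℚ_[p] (ℚ_[p] ⊗[ℤ_[p]] M) := by
  let e : RestrictScalars ℤ_[p] (IwasawaAlgebra p) M ≃ₗ[ℤ_[p]] M :=
    { RestrictScalars.addEquiv ℤ_[p] (IwasawaAlgebra p) M with
      map_smul' := fun c x => by
        change RestrictScalars.addEquiv ℤ_[p] (IwasawaAlgebra p) M (c • x) =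
          c • RestrictScalars.addEquiv ℤ_[p] (IwasawaAlgebra p) M x
        rw [RestrictScalars.addEquiv_map_smul, algebraMap_smul] }
  unfold lambdaInvariant
  exact (LinearEquiv.baseChange ℤ_[p] ℚ_[p] _ _ e).finrank_eq

/-- `λ` is invariant under `Λ`-linear isomorphisms. [folklore] -/
theorem lambdaInvariant_eq_of_linearEquiv {M N : Type*} [AddCommGroup M]
    [Module (IwasawaAlgebra p) M] [AddCommGroup N] [Module (IwasawaAlgebra p) N]
    (e : M ≃ₗ[IwasawaAlgebra p] N) : lambdaInvariant p M = lambdaInvariant p N := by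
  letI : Module ℤ_[p] M := Module.compHom M (algebraMap ℤ_[p] (IwasawaAlgebra p))
  haveI : IsScalarTower ℤ_[p] (IwasawaAlgebra p) M := IsScalarTower.of_compHom _ _ _
  letI : Module ℤ_[p] N := Module.compHom N (algebraMap ℤ_[p] (IwasawaAlgebra p))
  haveI : IsScalarTower ℤ_[p] (IwasawaAlgebra p) N := IsScalarTower.of_compHom _ _ _
  rw [lambdaInvariant_eq_finrank p M, lambdaInvariant_eq_finrank p N]
  exact (LinearEquiv.baseChange ℤ_[p] ℚ_[p] _ _ (e.restrictScalars ℤ_[p])).finrank_eq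

/-- **`λ(Λ/(p^k · P)) = deg P`** for a distinguished polynomial `P ∈ ℤ_p[T]` and `k ≥ 0`:
`ℚ_p ⊗ Λ/(p^k P) ≅ ℚ_p ⊗ Λ/(P)` (the kernel `(P)/(p^k P)` of the projection is killed by `p^k`,
`Module.finrank_baseChange_eq_of_pow_smul`) and `Λ/(P)` is `ℤ_p`-free of rank `deg P` by Weierstrass
division (`finrank_quotient_pow`). [cite: Washington1997, §13.2 Prop. 13.8] -/
theorem lambdaInvariant_quotient_C_pow_mul_coe (k : ℕ) {P : ℤ_[p][X]}
    (hP : P.IsDistinguishedAt (IsLocalRing.maximalIdeal ℤ_[p])) :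
    lambdaInvariant p (IwasawaAlgebra p ⧸
      Ideal.span {PowerSeries.C ((p : ℤ_[p]) ^ k) * (P : IwasawaAlgebra p)}) = P.natDegree := by
  set I : Ideal (IwasawaAlgebra p) :=
    Ideal.span {PowerSeries.C ((p : ℤ_[p]) ^ k) * (P : IwasawaAlgebra p)} with hI
  set J : Ideal (IwasawaAlgebra p) := Ideal.span {((P : IwasawaAlgebra p)) ^ 1} with hJ
  have hIJ : I ≤ J := by
    rw [hI, hJ, pow_one]
    exact Ideal.span_singleton_le_span_singleton.mpr (dvd_mul_left _ _)
  let ψ : (IwasawaAlgebra p ⧸ I) →ₗ[IwasawaAlgebra p] (IwasawaAlgebra p ⧸ J) := Submodule.factor hIJ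
  have hker : ∀ x : IwasawaAlgebra p ⧸ I, ψ.restrictScalars ℤ_[p] x = 0 →
      ∃ n : ℕ, (p : ℤ_[p]) ^ n • x = 0 := by
    intro x hx
    obtain ⟨a, rfl⟩ := Submodule.Quotient.mk_surjective I x
    refine ⟨k, ?_⟩
    have hx' : (Submodule.Quotient.mk a : IwasawaAlgebra p ⧸ J) = 0 := hx
    rw [Submodule.Quotient.mk_eq_zero, hJ, pow_one, Ideal.mem_span_singleton] at hx'
    obtain ⟨c, rfl⟩ := hx'
    rw [algebraMap_p_pow_smul p k, ← map_pow, ← Submodule.Quotient.mk_smul,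
      Submodule.Quotient.mk_eq_zero, smul_eq_mul, ← mul_assoc, hI]
    exact Ideal.mul_mem_right _ _ (Ideal.subset_span (Set.mem_singleton _))
  have hcoker : ∀ y : IwasawaAlgebra p ⧸ J, ∃ (n : ℕ) (x : IwasawaAlgebra p ⧸ I),
      (p : ℤ_[p]) ^ n • y = ψ.restrictScalars ℤ_[p] x := by
    intro y
    obtain ⟨a, rfl⟩ := Submodule.Quotient.mk_surjective J y
    exact ⟨0, Submodule.Quotient.mk a, by rw [pow_zero, one_smul]; rfl⟩
  haveI : Module.Flat ℤ_[p] ℚ_[p] := IsLocalization.flat ℚ_[p] (nonZeroDivisors ℤ_[p])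
  haveI := free_quotient_pow p hP 1
  haveI := finite_quotient_pow p hP 1
  rw [lambdaInvariant_eq_finrank,
    Module.finrank_baseChange_eq_of_pow_smul ℚ_[p] (isUnit_algebraMap_p p)
      (ψ.restrictScalars ℤ_[p]) hker hcoker,
    Module.finrank_baseChange, finrank_quotient_pow p hP 1, one_mul]

/-- **`μ(Λ/(p^k · P)) = k`** for a distinguished polynomial `P ∈ ℤ_p[T]`: the local length at the
height-one prime `(p)` is additive along `Λ/(P) ↪ Λ/(p^k P) ↠ Λ/(p^k)`
(`Module.lengthAt_quotient_span_singleton_mul`), `length (Λ/(p^k))_{(p)} = k`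
(`lengthAt_quotient_C_pow`) and `(Λ/(P))_{(p)} = 0` because `P ∉ (p)`
(`coe_notMem_augIdealP_of_isDistinguishedAt`). [cite: Washington1997, §13.2 (after Thm. 13.12)] -/
theorem muInvariant_quotient_C_pow_mul_coe (k : ℕ) {P : ℤ_[p][X]}
    (hP : P.IsDistinguishedAt (IsLocalRing.maximalIdeal ℤ_[p])) :
    muInvariant p (IwasawaAlgebra p ⧸
      Ideal.span {PowerSeries.C ((p : ℤ_[p]) ^ k) * (P : IwasawaAlgebra p)}) = k := by
  classical
  let 𝔭 : PrimeSpectrum (IwasawaAlgebra p) := ⟨augIdealP p, isPrime_augIdealP_holds p⟩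
  have h1 : 𝔭.asIdeal.height = 1 := height_augIdealP_holds p
  have hCmem : PowerSeries.C (p : ℤ_[p]) ∈ 𝔭.asIdeal := Ideal.subset_span (Set.mem_singleton _)
  have hC : (PowerSeries.C ((p : ℤ_[p]) ^ k) : IwasawaAlgebra p) ≠ 0 := by
    rw [map_pow]; exact pow_ne_zero _ (prime_C p).ne_zero
  have hPnot : ¬ Ideal.span {(P : IwasawaAlgebra p)} ≤ 𝔭.asIdeal := by
    rw [Ideal.span_singleton_le_iff_mem]
    exact coe_notMem_augIdealP_of_isDistinguishedAt p hP
  rw [muInvariant_eq_toNat_lengthAt p _ 𝔭 rfl,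
    Module.lengthAt_quotient_span_singleton_mul _ hC 𝔭, lengthAt_quotient_C_pow k 𝔭 h1,
    if_pos hCmem, Module.lengthAt_quotient_eq_zero_of_not_le hPnot, add_zero, nsmul_one,
    ENat.toNat_coe]

/-- **An element of `Λ = ℤ_p⟦T⟧` with `μ = m` and `λ = 0` is `p^m` times a unit.** For `h ≠ 0`
with `μ(Λ/(h)) = m` and `λ(Λ/(h)) = 0`: `h = C(p^m) · u` with `u ∈ Λˣ`. Proof: `h = p^k · b` with
`b ∉ pΛ` (`p`-content), `b = P · v` with `P` distinguished and `v` a unit (Weierstrass preparation,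
Washington Thm. 7.3), so `(h) = (p^k P)`, `μ = k`, `λ = deg P`; hence `k = m`, `P = 1`.
[cite: Washington1997, Thm. 7.3 and §13.2] -/
theorem exists_eq_C_pow_mul_unit_of_muInvariant_of_lambdaInvariant {h : IwasawaAlgebra p}
    (h0 : h ≠ 0) {m : ℕ} (hμ : muInvariant p (IwasawaAlgebra p ⧸ Ideal.span {h}) = m)
    (hlam : lambdaInvariant p (IwasawaAlgebra p ⧸ Ideal.span {h}) = 0) :
    ∃ u : (IwasawaAlgebra p)ˣ, h = PowerSeries.C ((p : ℤ_[p]) ^ m) * (u : IwasawaAlgebra p) := by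
  classical
  obtain ⟨k, b, hb, hbres⟩ := exists_eq_C_pow_mul_and_map_residue_ne_zero p h0
  obtain ⟨P, v, H⟩ := PowerSeries.exists_isWeierstrassFactorization hbres
  obtain ⟨u, hu⟩ := H.isUnit
  have hPd : P.IsDistinguishedAt (IsLocalRing.maximalIdeal ℤ_[p]) := H.isDistinguishedAt
  -- `(h) = (p^k P)`
  have hspan : Ideal.span {h} =
      Ideal.span {PowerSeries.C ((p : ℤ_[p]) ^ k) * (P : IwasawaAlgebra p)} := by
    rw [hb, H.eq_mul, ← mul_assoc, ← hu]
    exact Ideal.span_singleton_mul_right_unit u.isUnit _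
  let e := Submodule.quotEquivOfEq _ _ hspan
  let 𝔭 : PrimeSpectrum (IwasawaAlgebra p) := ⟨augIdealP p, isPrime_augIdealP_holds p⟩
  have hμ' : muInvariant p (IwasawaAlgebra p ⧸
      Ideal.span {PowerSeries.C ((p : ℤ_[p]) ^ k) * (P : IwasawaAlgebra p)}) = m := by
    rw [← hμ, muInvariant_eq_toNat_lengthAt p _ 𝔭 rfl, muInvariant_eq_toNat_lengthAt p _ 𝔭 rfl,
      Module.lengthAt_eq_of_linearEquiv e 𝔭]
  have hlam' : lambdaInvariant p (IwasawaAlgebra p ⧸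
      Ideal.span {PowerSeries.C ((p : ℤ_[p]) ^ k) * (P : IwasawaAlgebra p)}) = 0 := by
    rw [← hlam]; exact (lambdaInvariant_eq_of_linearEquiv p e).symm
  rw [muInvariant_quotient_C_pow_mul_coe p k hPd] at hμ'
  rw [lambdaInvariant_quotient_C_pow_mul_coe p k hPd] at hlam'
  have hP1 : P = 1 := hPd.monic.natDegree_eq_zero.mp hlam'
  subst hμ'
  refine ⟨u, ?_⟩
  rw [hb, H.eq_mul, hP1, Polynomial.coe_one, one_mul, hu]

end SignedTransportAtTwo

/-! ## §2. The registered stub at `p = 2` -/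

/-- **Stub `stub_unitOfInvariantsTwo` of the birth skeleton of `SignedTransportAtTwo` (PROVED).**
In `Λ = ℤ₂⟦T⟧`: if `h ≠ 0`, `μ(Λ/(h)) = m` and `λ(Λ/(h)) = 0`, then `ι h = 2^m · ι u` in `ℚ₂⟦T⟧`
for some unit `u ∈ Λˣ` (`ι = iwasawaToPowerSeries 2`). Immediate from
`SignedTransportAtTwo.exists_eq_C_pow_mul_unit_of_muInvariant_of_lambdaInvariant` at `p = 2`
(Weierstrass preparation; Washington Thm. 7.3, §13.2). [cite: Washington1997, Thm. 7.3 and §13.2] -/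
theorem stub_unitOfInvariantsTwo :
    ∀ (h : IwasawaAlgebra 2) (m : ℕ), h ≠ 0 →
      muInvariant 2 (IwasawaAlgebra 2 ⧸ Ideal.span {h}) = m →
      lambdaInvariant 2 (IwasawaAlgebra 2 ⧸ Ideal.span {h}) = 0 →
      ∃ u : (IwasawaAlgebra 2)ˣ,
        iwasawaToPowerSeries 2 h =
          PowerSeries.C ((2 : ℚ_[2]) ^ m) * iwasawaToPowerSeries 2 (u : IwasawaAlgebra 2) := by
  intro h m h0 hμ hlam
  obtain ⟨u, hu⟩ :=
    SignedTransportAtTwo.exists_eq_C_pow_mul_unit_of_muInvariant_of_lambdaInvariant 2 h0 hμ hlam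
  refine ⟨u, ?_⟩
  rw [hu, map_mul, PowerSeries.map_C, map_pow, map_natCast]
  rfl

end Summit.BirchSwinnertonDyer.BirchSwinnertonDyer.Theorems

end
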